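import Summits.CriticalPhenomena.PercolationContinuityZ3.Theses.PercNearOneGluing
import Literature.Probability.Percolation.PercolationEvents
import HarnessLib.Audit
import Summits.CriticalPhenomena.PercolationContinuityZ3.Theorems.PercNearOneGluingNearOneGluingVariants2411

/-! TTRL-lite variant V2439 of stmt-CriticalPhenomena-4574

(`stub_shorteningStep` of line `kn_shortening_induction`, move `small_case+small_case`:
`A.card = 2` and `n ≤ 4`, hypotheses in this order).  This variant is a weakening of the
already-landed sibling variant V2411 (`A.card = 2` alone, for every `n`,
`stub_shorteningStep_var2411`): the extra hypothesis `n ≤ 4` is simply discarded.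
Mathematically (see the module docstring of V2411): realise the glued measure
`μ₁ = prodBernoulli (w[s(v,x) ↦ 1])` as the image of `μ = prodBernoulli w` under `ω ↦ insert s(v,x) ω`,
apply Harris to the pulled-back events `{v ↔ A}` and `{a₀ ↔ b}`, and compare the two difference events
through Kozma–Nitzan's mixed-monotone exchange inequality for the second relay `a₁` (fed by the
minimiser hypothesis `μ(a₀ ↔ b) ≤ μ(a₁ ↔ b)`).  No new definitions, no named facts, the induction
hypothesis is not used. -/

namespace Summit.CriticalPhenomena.PercolationContinuityZ3.Theorems

open MeasureTheory Set Literature.Probability.LatticeModels Literature.Probability.Percolation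
open scoped Classical BigOperators

/-- TTRL-lite variant V2439 of `stub_shorteningStep` (stmt-CriticalPhenomena-4574, Kozma–Nitzan
Conjecture 6 with the induction hypothesis displayed): the shortening step
`μ₁(⋃ a ∈ A, v ↔ a) · μ₁(a₀ ↔ b) ≤ μ₁(v ↔ b)` for the glued measure `μ₁ = prodBernoulli (w[s(v,x) ↦ 1])`
in the small case `A.card = 2`, `n ≤ 4`.  Immediate from the sibling variant
`stub_shorteningStep_var2411` (case `A.card = 2`, any `n`). -/
theorem stub_shorteningStep_var2439 : ∀ (n : ℕ) (w : Sym2 (Fin n) → unitInterval) (A : Finset (Fin n)) (b v x a₀ : Fin n), A.card = 2 → n ≤ 4 → v ∉ A → v ≠ x → w s(v, x) = 0 → a₀ ∈ A → (∀ a ∈ A, (prodBernoulli w).real (openConn a₀ b) ≤ (prodBernoulli w).real (openConn a b)) → (∀ w' : Sym2 (Fin n) → unitInterval, (∀ e, w e = 0 → w' e = 0) → ∀ (A' : Finset (Fin n)) (o' b' : Fin n) (t : ℝ), (∀ a ∈ A', t ≤ (prodBernoulli w').real (openConn a b')) → (prodBernoulli w').real (⋃ a ∈ A', openConn o' a) *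 t ≤ (prodBernoulli w').real (openConn o' b')) → (prodBernoulli (Function.update w s(v, x) 1)).real (⋃ a ∈ A, openConn v a) * (prodBernoulli (Function.update w s(v, x) 1)).real (openConn a₀ b) ≤ (prodBernoulli (Function.update w s(v, x) 1)).real (openConn v b) := by
  intro n w A b v x a₀ hcard _hn
  exact stub_shorteningStep_var2411 n w A b v x a₀ hcard

end Summit.CriticalPhenomena.PercolationContinuityZ3.Theorems
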